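import Summits.BirchSwinnertonDyer.Rank1Residual.Supersingular.RankOneKimLevelKRecordShape
import Summits.BirchSwinnertonDyer.Rank1Residual.Supersingular.RankOneRem13NoCertificate
import HarnessLib

/-!
# Rank ONE at `p = 3`, `#Ш_an` a `3`-UNIT, `ord₃ ∏c_ℓ ≤ 1`: the level-`3^k` (`k ≤ 2`) PRIME-level Kurihara-number RECORD SHAPE
# with every side condition kernel-decidable — surj(3) by certificate, `ℓ ∈ 𝒫_k` from a point count, CYCLICITY by the cube test —
# leaving as binders only the number `δ̃_ℓ ≢ 0 (mod 3^k)`, `r_an = 1`, `#Ш_an` (cell `b2b-bsdres`, supersingular family prover B =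
# unit `b2b-bsdres-additive-p3`, gen 22; class lead N6·O3, X7 joint B side)

HONEST FRAMING (run/shared/lean/b2b/bsd-rank1-residual/, verbatim in every file): the goal of the
cell is to DELETE the COMBINATION-SHAPED residual classes of the Birch–Swinnerton-Dyer formula for
ALL analytic-rank `≤ 1` elliptic curves over `ℚ` — "full BSD formula for every rank `≤ 1` curve in
class `C`" assembled STRICTLY from published theorems — so that the rank-`≤ 1` remainder becomes
exactly the CONSTRUCTION-SHAPED classes, which are TYPED (missing-input `Prop`s), NOT attempted.
This is not "finishing BSD". X7 / X8 stay CONSTRUCTION-SHAPED; THEOREMS ONLY (compositions of tree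
theorems BY NAME; no definition, no named fact, debt 0); per pair; nothing booked; no mark moves.
EVERY theorem is CONDITIONAL on the ANNOUNCED preprint C.-H. Kim (app. R. Pollack), arXiv:2505.09121
Thm. 1.1 (`hK25s`, OPEN binder); `hCT` (Cassels–Tate), `hGZK`, `hmod` PUBLISHED.

## Why

Gen 21's `X8RankOne/X7RankOne.bsdp_iff_padicValRat_eq_zero_of_kim2025_OPEN_of_kuriharaNumber_ne_zero_of_surj`
(`GoodSSTowerOfSurj.lean`, p306705): in rank one at a good supersingular `3` with surj(3), ONE Kurihara number
`δ̃_ℓ ≢ 0 (mod 3^k)` at a CYCLIC Kolyvagin prime `ℓ ∈ 𝒫_k`, `1 ≤ k ≤ 2`, gives `BSD(E,3) ⟺ ord₃ #Ш_an = 0`.  iw-2's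
ENGINE K v1.3 depth-2 run (KP9, population R1k2 = r_an 1, X7/X8, surj, KP3 all-zero at ν = 1, `v₃(∏c) + v₃(#Ш_an) = 1`;
`HOME/b2b-bsdres-iw-2/ENGINE-K-P9.md` §4, tables `engKp9_{pairs,levels}.tsv`, kit j136942 / j137694) decided ALL 123 rows
with `min ord₃ δ̃^{(2)} = 1` = the expectation, i.e. a prime level `ℓ ∈ 𝒫_2` with `δ̃_ℓ ≢ 0 (mod 9)` on every row (ONE engine;
certificates feq / round_resid / dft).  The companion file `RankOneKimLevelKRecordShape.lean` (gen 21) is the `#Ш_an = 9` shape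
(descent bit); this file is the `#Ш_an` UNIT shape (no descent), for the 16 R1k2 rows still OPEN at engine-A R203 (O4@3 14, O3 2).

## What

* `X8RankOne.bsdp_three_of_kim2025_OPEN_of_ainvs_of_kuriharaNumber_ne_zero_of_shaAn_unit` — literal equation, minimality
  explicit, class X8 (`3 ∤ Δ`, `countPoints [a] 3 ∈ {1,7}`), `hsurj`, `r_an = 1`, `D`, `1 ≤ k ≤ 2`, a prime `ℓ ≥ 5`, `ℓ ∤ Δ`,
  `ℓ ≡ 1 (mod 3^k)`, `#(E mod ℓ)(𝔽_ℓ) = n_ℓ`, `3^k ∣ n_ℓ`, cube test, a `ψ` surjective at `ℓ` with `kuriharaNumber D.f (3^k) ℓ ψ ≠ 0`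
  (binder), `#Ш_an = q` with `ord₃ q = 0` ⟹ `BSD(E,3)`.
* `X7RankOne.bsdp_three_of_kim2025_OPEN_of_ainvs_of_kuriharaNumber_ne_zero_of_shaAn_unit` — the X7 twin (class X7 by
  `3 ∣ 4 − n₃` and an additive prime `q ∣ Δ`, `q ∣ c₄`, gen 20's `classX7_of_intModel`).

References: [Kim2025RefinedTNC] Thm. 1.1 (ANNOUNCED, OPEN binder); [Kim2022StructureSelmer] §1.2.2, Thm. 1.10 (1), Conj. 1.10;
[SilvermanAEC2009] III.1, VII.1, VII.5, X.4.14; [Wuthrich2014] Lemma 20 (p. 399); [IrelandRosen1990] Prop. 5.1.2; [Miller2011LMS] Def. 1.1.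
-/

set_option autoImplicit false

noncomputable section

open scoped Classical MatrixGroups ModularForm

open CongruenceSubgroup WeierstrassCurve Literature.NumberTheory.EllipticCurves
  Literature.NumberTheory.EllipticCurves.ModularForms
  Literature.NumberTheory.EllipticCurves.Rank1Residual
  Literature.NumberTheory.EllipticCurves.Rank1Residual.Typed
  Literature.NumberTheory.EllipticCurves.Rank1Residual.X11RankOneCertificates
  Summit.BirchSwinnertonDyer.BirchSwinnertonDyer.Rank1Residual.IntModel
  Summit.BirchSwinnertonDyer.BirchSwinnertonDyer.Rank1Residual.X11RankOne
  Summit.BirchSwinnertonDyer.Rank1Residual.X11b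
  Summit.BirchSwinnertonDyer.Rank1Residual.Additive

namespace Summit.BirchSwinnertonDyer.Rank1Residual.Supersingular

section Literal

/-- **RECORD SHAPE (rank one, X8, `#Ш_an` unit, prime level `ℓ ∈ 𝒫_k`, `k ≤ 2`).** For an integer equation
`[a₁,…,a₆]`: `hmin` (explicit), `3 ∤ Δ`, `countPoints [a] 3 ∈ {1,7}` (class X8); a prime `ℓ ≥ 5`, `ℓ ∤ Δ`, `ℓ ≡ 1 (mod 3^k)`
(`1 ≤ k ≤ 2`), `#(E mod ℓ)(𝔽_ℓ) = n_ℓ`, `3^k ∣ n_ℓ`, and the CUBE TEST `(Δ : ℤ/ℓ) ≠ 0`, `(Δ : ℤ/ℓ)^{(ℓ−1)/3} ≠ 1` — ALL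
kernel-decidable; binders: `hsurj` (gen 21's certificate `surj_x8r1_<label>_3`), `r_an = 1`, `D`, a `ψ` surjective at `ℓ` with
`kuriharaNumber D.f (3^k) ℓ ψ ≠ 0`, `#Ш_an = q` with `ord₃ q = 0` ⇒ **`BSD(E,3)`** (gen 21's
`X8RankOne.bsdp_iff_padicValRat_eq_zero_of_kim2025_OPEN_of_kuriharaNumber_ne_zero_of_surj`). CONDITIONAL on `hK25s` (OPEN) +
`hCT`/`hGZK`/`hmod` (PUBLISHED); no Manin / period / Tamagawa binder. Per pair; NOT a class theorem; nothing booked.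
[claim: Kim2025RefinedTNC, status: under-review] [cite: Kim2025RefinedTNC, Thm. 1.1 (ANNOUNCED, OPEN binder)]
[cite: Kim2022StructureSelmer, §1.2.2 and Thm. 1.10 (1)] [cite: SilvermanAEC2009, III.1, VII.1 Remark 1.1, VII.5 Prop. 5.1(a), Thm. X.4.14]
[cite: IrelandRosen1990, Prop. 5.1.2 and §8.1] [cite: Miller2011LMS, §1 and Def. 1.1] -/
theorem X8RankOne.bsdp_three_of_kim2025_OPEN_of_ainvs_of_kuriharaNumber_ne_zero_of_shaAn_unit
    (hK25s : Kim2025.thm11_kimShaLength_of_integralPeriod_OPEN)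
    (hCT : exists_casselsTate_pairing (K := ℚ))
    (hGZK : rank_eq_analyticRank_of_analyticRank_le_one) (hmod : hasEntireLFunction_rat)
    (a1 a2 a3 a4 a6 : ℤ) (hmin : (⟨a1, a2, a3, a4, a6⟩ : WeierstrassCurve ℚ).IsGloballyMinimal)
    (h3Δ : ¬ (3 : ℤ) ∣ discOf [a1, a2, a3, a4, a6]) {n₃ : ℕ}
    (hc₃ : countPoints [a1, a2, a3, a4, a6] 3 = n₃) (hn17 : n₃ = 1 ∨ n₃ = 7)
    (hsurj : Surj (⟨a1, a2, a3, a4, a6⟩ : WeierstrassCurve ℚ) 3)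
    (hr : (⟨a1, a2, a3, a4, a6⟩ : WeierstrassCurve ℚ).analyticRank = 1)
    {N : ℕ} [NeZero N] (D : ModularParametrizationData (⟨a1, a2, a3, a4, a6⟩ : WeierstrassCurve ℚ) N)
    {k : ℕ} (hk : 1 ≤ k) (hk2 : k ≤ 2) (ℓ : ℕ) [hℓ : Fact ℓ.Prime] (h5 : 5 ≤ ℓ)
    (hℓΔ : ¬ (ℓ : ℤ) ∣ discOf [a1, a2, a3, a4, a6]) (h1 : ℓ ≡ 1 [MOD 3 ^ k]) {nℓ : ℕ}
    (hnℓ : Nat.card (((⟨a1, a2, a3, a4, a6⟩ : WeierstrassCurve ℤ).map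
      (Int.castRingHom (ZMod ℓ))).toAffine.Point) = nℓ) (hdvd : 3 ^ k ∣ nℓ)
    (hΔ0 : ((discOf [a1, a2, a3, a4, a6] : ℤ) : ZMod ℓ) ≠ 0)
    (hχ : ((discOf [a1, a2, a3, a4, a6] : ℤ) : ZMod ℓ) ^ ((ℓ - 1) / 3) ≠ 1)
    (ψ : (ℓ'' : ℕ) → (ZMod ℓ'')ˣ →* Multiplicative (ZMod (3 ^ k)))
    (hψ : Function.Surjective (ψ ℓ))
    (hδ : kuriharaNumber D.f (3 ^ k) ℓ ψ ≠ 0)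
    {q : ℚ} (hq : shaAn (⟨a1, a2, a3, a4, a6⟩ : WeierstrassCurve ℚ) = (q : ℂ)) (hv : padicValRat 3 q = 0) :
    BSDp (⟨a1, a2, a3, a4, a6⟩ : WeierstrassCurve ℚ) 3 := by
  have h0 : discOf [a1, a2, a3, a4, a6] ≠ 0 := fun h ↦ h3Δ (by rw [h]; exact dvd_zero _)
  haveI := isElliptic_of_discOf_ne_zero a1 a2 a3 a4 a6 h0
  haveI := hmin
  haveI : Fact (Nat.Prime 3) := ⟨by norm_num⟩
  have hI : integralModelInt (⟨a1, a2, a3, a4, a6⟩ : WeierstrassCurve ℚ) = ⟨a1, a2, a3, a4, a6⟩ :=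
    integralModelInt_eq_of_map_eq _ (map_mk_int a1 a2 a3 a4 a6)
  have hΔℓ : ((⟨a1, a2, a3, a4, a6⟩ : WeierstrassCurve ℤ).map (Int.castRingHom (ZMod ℓ))).Δ =
      ((discOf [a1, a2, a3, a4, a6] : ℤ) : ZMod ℓ) := by
    rw [WeierstrassCurve.map_Δ, intCurve_Δ, eq_intCast]
  have hX : ClassX8 (⟨a1, a2, a3, a4, a6⟩ : WeierstrassCurve ℚ) 3 :=
    classX8_of_intModel hI (by rw [intCurve_Δ]; exact h3Δ)
      (natCard_point_eq_of_countPoints a1 a2 a3 a4 a6 3 (by decide) h3Δ hc₃) hn17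
  rw [X8RankOne.bsdp_iff_padicValRat_eq_zero_of_kim2025_OPEN_of_kuriharaNumber_ne_zero_of_surj _ hK25s hCT
    hGZK hmod hr hX hsurj D hk hk2 ℓ
    (isKolyvaginPrime_of_intModel_of_card hI 3 k ℓ (by omega) (by rw [intCurve_Δ]; exact hℓΔ) h1 hnℓ hdvd)
    (card_three_torsion_le_of_intModel_of_pow_div_three_ne_one hI ℓ (by rw [hΔℓ]; exact hΔ0) (by rw [hΔℓ]; exact hχ) h5
      (three_dvd_sub_one_of_modEq_pow hk h1)) ψ hψ hδ hq]
  exact hv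

/-- **RECORD SHAPE (rank one, X7 at `3`, `#Ш_an` unit, prime level `ℓ ∈ 𝒫_k`, `k ≤ 2`)** — the X7 twin: class X7 from
`3 ∤ Δ`, `countPoints [a] 3 = n₃` with `3 ∣ 3 + 1 − n₃` and an ADDITIVE prime `q'` (`q' ∣ Δ`, `q' ∣ c₄`; gen 20's
`classX7_of_intModel`); everything else as the X8 shape; conclusion via gen 21's
`X7RankOne.bsdp_iff_padicValRat_eq_zero_of_kim2025_OPEN_of_kuriharaNumber_ne_zero_of_surj`. CONDITIONAL on `hK25s` (OPEN) +
`hCT`/`hGZK`/`hmod` (PUBLISHED); X7 joint pair, B side. Per pair; NOT a class theorem; nothing booked.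
[claim: Kim2025RefinedTNC, status: under-review] [cite: Kim2025RefinedTNC, Thm. 1.1 (ANNOUNCED, OPEN binder)]
[cite: Kim2022StructureSelmer, §1.2.2 and Thm. 1.10 (1)] [cite: SilvermanAEC2009, III.1, VII.1 Remark 1.1, VII.5 Prop. 5.1(a) and (c), Thm. X.4.14]
[cite: IrelandRosen1990, Prop. 5.1.2 and §8.1] [cite: Miller2011LMS, §1 and Def. 1.1] -/
theorem X7RankOne.bsdp_three_of_kim2025_OPEN_of_ainvs_of_kuriharaNumber_ne_zero_of_shaAn_unit
    (hK25s : Kim2025.thm11_kimShaLength_of_integralPeriod_OPEN)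
    (hCT : exists_casselsTate_pairing (K := ℚ))
    (hGZK : rank_eq_analyticRank_of_analyticRank_le_one) (hmod : hasEntireLFunction_rat)
    (a1 a2 a3 a4 a6 : ℤ) (hmin : (⟨a1, a2, a3, a4, a6⟩ : WeierstrassCurve ℚ).IsGloballyMinimal)
    (h3Δ : ¬ (3 : ℤ) ∣ discOf [a1, a2, a3, a4, a6]) {n₃ : ℕ}
    (hc₃ : countPoints [a1, a2, a3, a4, a6] 3 = n₃) (ha₃ : (3 : ℤ) ∣ (3 : ℤ) + 1 - n₃)
    (q' : ℕ) (hq' : q'.Prime) (hqΔ : (q' : ℤ) ∣ discOf [a1, a2, a3, a4, a6]) (hqc₄ : (q' : ℤ) ∣ c4Of [a1, a2, a3, a4, a6])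
    (hsurj : Surj (⟨a1, a2, a3, a4, a6⟩ : WeierstrassCurve ℚ) 3)
    (hr : (⟨a1, a2, a3, a4, a6⟩ : WeierstrassCurve ℚ).analyticRank = 1)
    {N : ℕ} [NeZero N] (D : ModularParametrizationData (⟨a1, a2, a3, a4, a6⟩ : WeierstrassCurve ℚ) N)
    {k : ℕ} (hk : 1 ≤ k) (hk2 : k ≤ 2) (ℓ : ℕ) [hℓ : Fact ℓ.Prime] (h5 : 5 ≤ ℓ)
    (hℓΔ : ¬ (ℓ : ℤ) ∣ discOf [a1, a2, a3, a4, a6]) (h1 : ℓ ≡ 1 [MOD 3 ^ k]) {nℓ : ℕ}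
    (hnℓ : Nat.card (((⟨a1, a2, a3, a4, a6⟩ : WeierstrassCurve ℤ).map
      (Int.castRingHom (ZMod ℓ))).toAffine.Point) = nℓ) (hdvd : 3 ^ k ∣ nℓ)
    (hΔ0 : ((discOf [a1, a2, a3, a4, a6] : ℤ) : ZMod ℓ) ≠ 0)
    (hχ : ((discOf [a1, a2, a3, a4, a6] : ℤ) : ZMod ℓ) ^ ((ℓ - 1) / 3) ≠ 1)
    (ψ : (ℓ'' : ℕ) → (ZMod ℓ'')ˣ →* Multiplicative (ZMod (3 ^ k)))
    (hψ : Function.Surjective (ψ ℓ))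
    (hδ : kuriharaNumber D.f (3 ^ k) ℓ ψ ≠ 0)
    {q : ℚ} (hq : shaAn (⟨a1, a2, a3, a4, a6⟩ : WeierstrassCurve ℚ) = (q : ℂ)) (hv : padicValRat 3 q = 0) :
    BSDp (⟨a1, a2, a3, a4, a6⟩ : WeierstrassCurve ℚ) 3 := by
  have h0 : discOf [a1, a2, a3, a4, a6] ≠ 0 := fun h ↦ h3Δ (by rw [h]; exact dvd_zero _)
  haveI := isElliptic_of_discOf_ne_zero a1 a2 a3 a4 a6 h0
  haveI := hmin
  haveI : Fact (Nat.Prime 3) := ⟨by norm_num⟩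
  have hI : integralModelInt (⟨a1, a2, a3, a4, a6⟩ : WeierstrassCurve ℚ) = ⟨a1, a2, a3, a4, a6⟩ :=
    integralModelInt_eq_of_map_eq _ (map_mk_int a1 a2 a3 a4 a6)
  have hΔℓ : ((⟨a1, a2, a3, a4, a6⟩ : WeierstrassCurve ℤ).map (Int.castRingHom (ZMod ℓ))).Δ =
      ((discOf [a1, a2, a3, a4, a6] : ℤ) : ZMod ℓ) := by
    rw [WeierstrassCurve.map_Δ, intCurve_Δ, eq_intCast]
  have hX : ClassX7 (⟨a1, a2, a3, a4, a6⟩ : WeierstrassCurve ℚ) 3 :=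
    classX7_of_intModel (p := 3) hI (by rw [intCurve_Δ]; exact h3Δ)
      (natCard_point_eq_of_countPoints a1 a2 a3 a4 a6 3 (by decide) h3Δ hc₃) ha₃ q' hq'
      (by rw [intCurve_Δ]; exact hqΔ) (by rw [intCurve_c₄]; exact hqc₄)
  rw [X7RankOne.bsdp_iff_padicValRat_eq_zero_of_kim2025_OPEN_of_kuriharaNumber_ne_zero_of_surj _ hK25s hCT
    hGZK hmod hr hX hsurj D hk hk2 ℓ
    (isKolyvaginPrime_of_intModel_of_card hI 3 k ℓ (by omega) (by rw [intCurve_Δ]; exact hℓΔ) h1 hnℓ hdvd)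
    (card_three_torsion_le_of_intModel_of_pow_div_three_ne_one hI ℓ (by rw [hΔℓ]; exact hΔ0) (by rw [hΔℓ]; exact hχ) h5
      (three_dvd_sub_one_of_modEq_pow hk h1)) ψ hψ hδ hq]
  exact hv

end Literal

end Summit.BirchSwinnertonDyer.Rank1Residual.Supersingular

end
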